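import Summits.QuantumFields.BalabanUV.T4Continuum.Spine.NE1p.DressedRootFam
import Summits.QuantumFields.BalabanUV.T4Continuum.Spine.NE1p.DressedPositionalCount
import Literature.MathematicalPhysics.QuantumFieldTheory.Balaban1983to89.T4WeightBudget

/-!
# T⁴ programme, spine estimate NE1′ (node O3b/H2) — LEAF L-C FOR THE FAMILY DOOR («S4-fam»): THE HISTORY-WEIGHTED LIVE-FAMILY COUNT
# (`BookingLeavesFam.hS` ∕ `BookingLeavesFam.hcountH`) AND END-B-fam's CUBE-SIDE WEIGHTED COUNT (`hcountHq`) FROM HOUSING, COMPONENT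
# VOLUME AND A WEIGHTED POSITIONAL COUNT ∕ A WEIGHTED ANCHORING MULTIPLICITY — row S4's counting layer with the history weights carried

Cell `pub-balaban`, sub-cell `t4`, BINDER-OWNERS row NE1′ (owner skeleton `t4/skeletons/NE1p-t4-ne1p-p1.md` §1 ROOT-B ∕ END-B-fam, §2 leaf
L-C); crew `b2b-balaban-t4-ne1p-formalise-*`, row **S49 ∕ DAG N29zzzh** of `t4/formal/NE1p/LEAVES.md` (BOOKED by typer RULING R-T133,
CLAIMS.log l.21219, on INTENT l.21133), unit `b2b-balaban-t4-ne1p-formalise-leaf-02` (gen 15); companion of row S4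
`Spine/NE1p/DressedPositionalCount` (leaf-10) exactly as S5d `DressedBirthSuppliersFam` is the companion of S5.  ADDITIVE — imports
`Spine/NE1p/DressedRootFam` (owner g23, p211697: `BookingLeavesFam`, `dressedBudget_of_familyLeaves`), `Spine/NE1p/DressedPositionalCount`
(S4, p212703∕p212973: `birthScale_le_of_housed` BY NAME) and the Literature module `Balaban1983to89/T4WeightBudget` (`sum_biUnion_le_sum` BY
NAME) ONLY; theorems only (0 def, 0 `def … : Prop`, 0 cite); NOTHING of S4 ∕ `DressedRootFam` ∕ `T4FeltGeometry` restated.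

WHAT THE LEAF IS.  END-B-fam `DressedRootFam.dressedBudget_of_familyLeaves` consumes, per cutoff, a `BookingLeavesFam U Bk T` bundle whose
count fields are
* `hS      : ∀ k b, ∀ f ∈ S k b, Bk.birthScale f ≤ k` (live families are born) and
* `hcountH : ∀ k b, ∀ j ≤ k, Σ_{f ∈ (S k b).filter (birthScale · = j)} H f ≤ U.N₀ · U.Λ^{k−j}` — the live families of a met component
  counted WITH THEIR HISTORY WEIGHTS `H` (the booking cannot hide them: `NE1pFamilyBudget.card_le_sumH`),
and, on the cubes, the binder
* `hcountHq : ∀ q j, j ≤ k_q → Σ_{b ∈ Bk.feltOfScale q j} H b ≤ U.N₀ · U.Λ^{k_q−j}` — a WEIGHTED POSITIONAL COUNT.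
Row S4 discharges the UNWEIGHTED twins (`BookingLeaves.hS`∕`hcount`, `PositionalCount`) from counting shadows: housing + component volume +
the booking's positional count ∕ a block-lattice anchoring with per-block multiplicity.  This module carries the history weights through the
SAME two layers, so that ONE weighted certificate on the cubes serves both weighted binders of the family door:
* §1 (abstract layer) `sumH_filter_live_le`: live families HOUSED in a component of at most `v` cubes of scale `k` and a weighted positional
  count `Σ_{b ∈ feltOfScale q j} H b ≤ NH j k_q` (nonnegative weights and profile) give `Σ_{f ∈ S k b, j_f = j} H f ≤ v · NH j k`
  (`T4WeightBudget.sum_biUnion_le_sum` BY NAME in place of `card_biUnion_le`); `countH_of_housed`: with displayed `(N₀, Λ)` dominating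
  `v · NH j k ≤ N₀ Λ^{k−j}` — LITERALLY the field type of `BookingLeavesFam.hcountH`; `hS` is S4's `birthScale_le_of_housed` BY NAME (the
  housing binder is the same).
* §2 (anchoring layer) `sumH_feltSet_le`: the weighted twin of `T4FeltGeometry.card_feltSet_le` — a per-block WEIGHTED multiplicity
  `Σ_{b : j_b = j, x ∈ dom b} H b ≤ mH` gives `Σ_{b ∈ feltSet …} H b ≤ mH · (L^n)^d`; `weightedCount_of_anchoring`: for an anchoring
  `A : T4FeltGeometry.Anchoring Bk d L` (`0 < L`) the cube-side weighted count `Σ_{b ∈ feltOfScale q j} H b ≤ mH · (L^d)^{k_q−j}` — END-B-fam's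
  `hcountHq` at `N₀ = mH`, `Λ = L^d`; `countH_of_anchoring`: with housing and volume `v`, `hcountH` at `N₀ = v·mH`, `Λ = L^d`.
* §3 `bookingCountH_of_anchoring`: the two `BookingLeavesFam` count fields `hS ∧ hcountH` with the `U.N₀`, `U.Λ` of a
  `DressedRoot.UniformConstants` under the displayed comparison `v · mH ≤ U.N₀`, `U.Λ = L^d`; `hcountHq_of_anchoring`: END-B-fam's cube-side
  binder VERBATIM for a dressed tower anchored at every cutoff (`mH ≤ U.N₀`); the unit-weight case `H ≡ 1` IS row S4 (`example`, via
  `NE1pFamilyBudget.sumH_one_eq_card`).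

HONEST FRAMING.  Finite combinatorics ([folklore]); rung (B)+1 bookkeeping on ONE finite four-torus — NOT infinite volume, NOT a mass gap, NOT
OS on ℝ⁴, NOT Clay, NOT summit progress.  NOTHING of Bałaban's components, domains or D-terms is asserted: which cubes form a met component, that
live families are housed in it, the volume `v`, the history weights `H` and the weighted multiplicity `mH` are DISPLAYED BINDERS — in particular
this file does NOT pay the history price: it only relocates WHERE door 2 pays it (from the two weighted counts of END-B-fam to ONE weighted
multiplicity per block of the anchoring), and does NOT say which door the cell takes (`t4/ideate/NE1p-WALL.md` §5 — the owner's ∕ the wall's).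
Headline (c4): «L-C (family door) ⇐ housing + component volume + weighted positional count ∕ weighted anchoring multiplicity», NEVER «NE1′
proved»; NE1′ NOT PRINTED, NOT PROVED; 0 binders instantiated on Bałaban's densities; discharges no wall item; wall v1.7 (T4-DAG v47) does NOT
move; R-t4r2-Q2 NOT met; spine PROVED 0∕9 unchanged; count 9 unchanged.  0 sorry; no `def … : Prop`.  HONEST DEPENDENCY: continuum YM on T⁴ ⇐
BetaPertH ∧ nine spine estimates (0/9 proved); BetaPertH ⇐ (D1) ∧ (D4) ∧ CAP+tail; G-an2-4 gates asym, D1 and NE2/3/4.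
-/

namespace Summit.QuantumFields.BalabanUV.T4Continuum.NE1p.DressedPositionalCountFam

open Finset
open scoped BigOperators
open Literature.MathematicalPhysics.QuantumFieldTheory.Balaban1983to89
open Literature.MathematicalPhysics.QuantumFieldTheory.Balaban1983to89.T4TermFormat
open Literature.MathematicalPhysics.QuantumFieldTheory.Balaban1983to89.T4FeltGeometry
open Literature.MathematicalPhysics.QuantumFieldTheory.Balaban1983to89.T4WeightBudget (sum_biUnion_le_sum)
open Summit.QuantumFields.BalabanUV.T4Continuum.NE1pFamilyBudget (sumH_one_eq_card)
open Summit.QuantumFields.BalabanUV.T4Continuum.NE1p.DressedRoot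
open Summit.QuantumFields.BalabanUV.T4Continuum.NE1p.DressedPositionalCount (birthScale_le_of_housed positionalCount_mono)

variable {Bk : T4TermFormat.Booking}

/-! ## §1 Abstract layer: housing + component volume + a WEIGHTED positional count ⟹ `hcountH` -/

/-- **THE WEIGHTED COUNT PER COMPONENT** [bookkeeping]: live families of birth scale `j` HOUSED in a component of at most `v` cubes of
scale `k`, nonnegative history weights `H` and a weighted positional count on the cubes `Σ_{b ∈ feltOfScale q j} H b ≤ NH j k_q` (nonnegative
profile) give `Σ_{f ∈ S k b, j_f = j} H f ≤ v · NH j k` — the scale-`j` live families sit in the union over the component's cubes of the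
scale-`j` births felt there; subadditivity of nonnegative sums over the union (`T4WeightBudget.sum_biUnion_le_sum` BY NAME) in place of
S4's `card_biUnion_le`. [folklore] -/
theorem sumH_filter_live_le {comp : ℕ → Bk.Birth → Finset Bk.Cube} {S : ℕ → Bk.Birth → Finset Bk.Birth}
    {H : Bk.Birth → ℝ} {NH : ℕ → ℕ → ℝ} {v : ℕ} (hH : ∀ f, 0 ≤ H f)
    (hNH : ∀ (q : Bk.Cube) (j : ℕ), ∑ b ∈ Bk.feltOfScale q j, H b ≤ NH j (Bk.cubeScale q))
    (hscale : ∀ k b, ∀ q ∈ comp k b, Bk.cubeScale q = k)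
    (hhoused : ∀ k b, ∀ f ∈ S k b, ∃ q ∈ comp k b, f ∈ Bk.feltAt q)
    (hvol : ∀ k b, (comp k b).card ≤ v) (hNH0 : ∀ j k, 0 ≤ NH j k) (k : ℕ) (b : Bk.Birth) (j : ℕ) :
    ∑ f ∈ (S k b).filter (fun f => Bk.birthScale f = j), H f ≤ (v : ℝ) * NH j k := by
  classical
  have hsub : ((S k b).filter fun f => Bk.birthScale f = j) ⊆ (comp k b).biUnion fun q => Bk.feltOfScale q j := by
    intro f hf
    obtain ⟨hfS, hfj⟩ := mem_filter.mp hf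
    obtain ⟨q, hq, hfq⟩ := hhoused k b f hfS
    exact mem_biUnion.mpr ⟨q, hq, Booking.mem_feltOfScale.mpr ⟨hfq, hfj⟩⟩
  calc ∑ f ∈ (S k b).filter (fun f => Bk.birthScale f = j), H f
      ≤ ∑ f ∈ (comp k b).biUnion (fun q => Bk.feltOfScale q j), H f :=
        sum_le_sum_of_subset_of_nonneg hsub fun f _ _ => hH f
    _ ≤ ∑ q ∈ comp k b, ∑ f ∈ Bk.feltOfScale q j, H f := sum_biUnion_le_sum _ _ hH
    _ ≤ ∑ q ∈ comp k b, NH j k := sum_le_sum fun q hq => by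
        have h := hNH q j
        rw [hscale k b q hq] at h
        exact h
    _ = ((comp k b).card : ℝ) * NH j k := by rw [sum_const, nsmul_eq_mul]
    _ ≤ (v : ℝ) * NH j k := mul_le_mul_of_nonneg_right (by exact_mod_cast hvol k b) (hNH0 j k)

/-- **`hcountH` FROM HOUSING + VOLUME + WEIGHTED POSITIONAL COUNT** [bookkeeping]: with displayed constants `N₀`, `Λ` dominating
`v · NH j k ≤ N₀·Λ^{k−j}` (`j ≤ k`), the weighted live-family count holds LITERALLY in the field type of `BookingLeavesFam.hcountH`. [folklore] -/
theorem countH_of_housed {comp : ℕ → Bk.Birth → Finset Bk.Cube} {S : ℕ → Bk.Birth → Finset Bk.Birth}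
    {H : Bk.Birth → ℝ} {NH : ℕ → ℕ → ℝ} {v : ℕ} {N₀ Λ : ℝ} (hH : ∀ f, 0 ≤ H f)
    (hNH : ∀ (q : Bk.Cube) (j : ℕ), ∑ b ∈ Bk.feltOfScale q j, H b ≤ NH j (Bk.cubeScale q))
    (hscale : ∀ k b, ∀ q ∈ comp k b, Bk.cubeScale q = k)
    (hhoused : ∀ k b, ∀ f ∈ S k b, ∃ q ∈ comp k b, f ∈ Bk.feltAt q)
    (hvol : ∀ k b, (comp k b).card ≤ v) (hNH0 : ∀ j k, 0 ≤ NH j k)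
    (hdom : ∀ j k, j ≤ k → (v : ℝ) * NH j k ≤ N₀ * Λ ^ (k - j)) :
    ∀ k b, ∀ j ≤ k, ∑ f ∈ (S k b).filter (fun f => Bk.birthScale f = j), H f ≤ N₀ * Λ ^ (k - j) :=
  fun k b j hj => (sumH_filter_live_le hH hNH hscale hhoused hvol hNH0 k b j).trans (hdom j k hj)

/-- **UNIT WEIGHTS ARE ROW S4** [consistency]: with `H ≡ 1` the weighted positional count IS `PositionalCount NH` and §1's conclusion IS
S4's `card_filter_live_le` (`NE1pFamilyBudget.sumH_one_eq_card`). [folklore] -/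
example {comp : ℕ → Bk.Birth → Finset Bk.Cube} {S : ℕ → Bk.Birth → Finset Bk.Birth} {NH : ℕ → ℕ → ℝ} {v : ℕ}
    (hN : Bk.PositionalCount NH) (hscale : ∀ k b, ∀ q ∈ comp k b, Bk.cubeScale q = k)
    (hhoused : ∀ k b, ∀ f ∈ S k b, ∃ q ∈ comp k b, f ∈ Bk.feltAt q)
    (hvol : ∀ k b, (comp k b).card ≤ v) (hNH0 : ∀ j k, 0 ≤ NH j k) (k : ℕ) (b : Bk.Birth) (j : ℕ) :
    (((S k b).filter fun f => Bk.birthScale f = j).card : ℝ) ≤ (v : ℝ) * NH j k := by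
  rw [← sumH_one_eq_card]
  refine sumH_filter_live_le (H := fun _ => (1 : ℝ)) (fun _ => zero_le_one) (fun q j' => ?_) hscale hhoused hvol hNH0 k b j
  have h := hN q j'
  unfold Booking.feltOfScale
  rw [sumH_one_eq_card]
  exact h

/-! ## §2 Anchoring layer: a WEIGHTED per-block multiplicity ⟹ the weighted positional count (`hcountHq`) and `hcountH` -/

section Weighted

variable {β : Type*} {d : ℕ}

/-- **WEIGHTED POSITIONAL COUNT OVER A BLOCK** [bookkeeping] (the weighted twin of `T4FeltGeometry.card_feltSet_le`): if the scale-`j`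
births whose domains contain a given `j`-block weigh at most `mH` IN TOTAL (`Σ H ≤ mH`, nonnegative weights), then the scale-`j` births felt
at a block `n` scales up weigh at most `mH · (L^n)^d` (`0 < L`): the felt set is covered by the `(L^n)^d` fibres over the box
(`coarsen_eq_iff_mem_box`, `card_box` BY NAME), each of weighted multiplicity `≤ mH`. [folklore] -/
theorem sumH_feltSet_le {S : Finset β} {scale : β → ℕ} {dom : β → Finset (Fin d → ℕ)} {H : β → ℝ} {L : ℕ} (hL : 0 < L)
    {mH : ℝ} (hH : ∀ b, 0 ≤ H b) (j n : ℕ) (y : Fin d → ℕ)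
    (hmult : ∀ x : Fin d → ℕ, ∑ b ∈ S.filter (fun b => scale b = j ∧ x ∈ dom b), H b ≤ mH) :
    ∑ b ∈ feltSet S scale dom L j n y, H b ≤ mH * ((L : ℝ) ^ n) ^ d := by
  classical
  have hsub : feltSet S scale dom L j n y ⊆ (box L n y).biUnion fun x => S.filter fun b => scale b = j ∧ x ∈ dom b := by
    intro b hb
    rcases mem_feltSet.1 hb with ⟨hS, hj, x, hx, hxy⟩
    exact mem_biUnion.2 ⟨x, (coarsen_eq_iff_mem_box hL n x y).1 hxy, mem_filter.2 ⟨hS, hj, hx⟩⟩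
  calc ∑ b ∈ feltSet S scale dom L j n y, H b
      ≤ ∑ b ∈ (box L n y).biUnion (fun x => S.filter fun b => scale b = j ∧ x ∈ dom b), H b :=
        sum_le_sum_of_subset_of_nonneg hsub fun b _ _ => hH b
    _ ≤ ∑ x ∈ box L n y, ∑ b ∈ S.filter (fun b => scale b = j ∧ x ∈ dom b), H b := sum_biUnion_le_sum _ _ hH
    _ ≤ ∑ _x ∈ box L n y, mH := sum_le_sum fun x _ => hmult x
    _ = mH * ((L : ℝ) ^ n) ^ d := by
        rw [sum_const, card_box, nsmul_eq_mul, mul_comm]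
        push_cast
        ring

end Weighted

section AnchoringInstance

variable {d L : ℕ} (A : Anchoring Bk d L)

/-- **END-B-fam's CUBE-SIDE WEIGHTED COUNT FROM A WEIGHTED ANCHORING MULTIPLICITY** [bookkeeping]: a block-lattice anchoring with
blocking factor `L > 0` whose per-block WEIGHTED multiplicity is `≤ mH` (the scale-`j` births whose domains contain a `j`-block weigh
`≤ mH` in total) gives `Σ_{b ∈ feltOfScale q j} H b ≤ mH · (L^d)^{k_q − j}` at every cube — the `hcountHq` binder of
`DressedRootFam.dressedBudget_of_familyLeaves` with `N₀ = mH`, `Λ = L^d` (`A.feltOfScale_subset_feltSet` BY NAME; S4's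
`positionalCount_of_anchoring` is the case `H ≡ 1`). [folklore] -/
theorem weightedCount_of_anchoring (hL : 0 < L) {H : Bk.Birth → ℝ} (hH : ∀ f, 0 ≤ H f) {mH : ℝ}
    (hmult : ∀ j (x : Fin d → ℕ), ∑ b ∈ Bk.births.filter (fun b => Bk.birthScale b = j ∧ x ∈ A.dom b), H b ≤ mH) :
    ∀ (q : Bk.Cube) (j : ℕ), ∑ b ∈ Bk.feltOfScale q j, H b ≤ mH * ((L : ℝ) ^ d) ^ (Bk.cubeScale q - j) := by
  intro q j
  calc ∑ b ∈ Bk.feltOfScale q j, H b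
      ≤ ∑ b ∈ feltSet Bk.births Bk.birthScale A.dom L j (Bk.cubeScale q - j) (A.center q), H b :=
        sum_le_sum_of_subset_of_nonneg (A.feltOfScale_subset_feltSet q j) fun b _ _ => hH b
    _ ≤ mH * ((L : ℝ) ^ (Bk.cubeScale q - j)) ^ d := sumH_feltSet_le hL hH j _ _ (hmult j)
    _ = mH * ((L : ℝ) ^ d) ^ (Bk.cubeScale q - j) := by rw [← pow_mul, ← pow_mul, mul_comm (Bk.cubeScale q - j) d]

/-- **`hcountH` FOR ANCHORED BOOKINGS WITH HISTORY WEIGHTS** [bookkeeping]: weighted anchoring multiplicity `mH` + housing + component volume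
`v` give the weighted live-family count `≤ (v·mH)·(L^d)^{k−j}` — `BookingLeavesFam.hcountH` with `N₀ = v·mH`, `Λ = L^d`. [folklore] -/
theorem countH_of_anchoring (hL : 0 < L) {H : Bk.Birth → ℝ} (hH : ∀ f, 0 ≤ H f) {mH : ℝ} (hmH : 0 ≤ mH) {v : ℕ}
    (hmult : ∀ j (x : Fin d → ℕ), ∑ b ∈ Bk.births.filter (fun b => Bk.birthScale b = j ∧ x ∈ A.dom b), H b ≤ mH)
    {comp : ℕ → Bk.Birth → Finset Bk.Cube} {S : ℕ → Bk.Birth → Finset Bk.Birth}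
    (hscale : ∀ k b, ∀ q ∈ comp k b, Bk.cubeScale q = k)
    (hhoused : ∀ k b, ∀ f ∈ S k b, ∃ q ∈ comp k b, f ∈ Bk.feltAt q)
    (hvol : ∀ k b, (comp k b).card ≤ v) :
    ∀ k b, ∀ j ≤ k, ∑ f ∈ (S k b).filter (fun f => Bk.birthScale f = j), H f ≤ ((v : ℝ) * mH) * ((L : ℝ) ^ d) ^ (k - j) := by
  refine countH_of_housed (NH := fun j k => mH * ((L : ℝ) ^ d) ^ (k - j)) hH (weightedCount_of_anchoring A hL hH hmult) hscale
    hhoused hvol (fun j k => by positivity) ?_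
  intro j k _
  rw [mul_assoc]

end AnchoringInstance

/-! ## §3 The two `BookingLeavesFam` count fields and END-B-fam's cube-side binder with ONE `UniformConstants` -/

/-- **LEAF L-C FOR THE FAMILY DOOR** [bookkeeping]: for a `U : UniformConstants` whose count constants dominate the weighted anchored ones
(`v·mH ≤ U.N₀`, `U.Λ = L^d`), housing + component volume + a weighted anchoring multiplicity give BOTH count fields `hS` and `hcountH` of
`DressedRootFam.BookingLeavesFam U Bk T` for the live-family finsets `S` and the history weights `H` — VERBATIM (S4's `birthScale_le_of_housed`
BY NAME for `hS`).  Nothing of Bałaban's components asserted; `v`, `mH`, `H`, the anchoring and the housing are displayed binders. [folklore] -/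
theorem bookingCountH_of_anchoring (U : UniformConstants) {d L : ℕ} (A : Anchoring Bk d L) (hL : 0 < L)
    {H : Bk.Birth → ℝ} (hH : ∀ f, 0 ≤ H f) {mH : ℝ} (hmH : 0 ≤ mH) {v : ℕ}
    (hmult : ∀ j (x : Fin d → ℕ), ∑ b ∈ Bk.births.filter (fun b => Bk.birthScale b = j ∧ x ∈ A.dom b), H b ≤ mH)
    {comp : ℕ → Bk.Birth → Finset Bk.Cube} {S : ℕ → Bk.Birth → Finset Bk.Birth}
    (hscale : ∀ k b, ∀ q ∈ comp k b, Bk.cubeScale q = k)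
    (hhoused : ∀ k b, ∀ f ∈ S k b, ∃ q ∈ comp k b, f ∈ Bk.feltAt q)
    (hvol : ∀ k b, (comp k b).card ≤ v) (hN₀ : (v : ℝ) * mH ≤ U.N₀) (hΛ : U.Λ = (L : ℝ) ^ d) :
    (∀ k b, ∀ f ∈ S k b, Bk.birthScale f ≤ k) ∧
      ∀ k b, ∀ j ≤ k, ∑ f ∈ (S k b).filter (fun f => Bk.birthScale f = j), H f ≤ U.N₀ * U.Λ ^ (k - j) := by
  refine ⟨birthScale_le_of_housed hscale hhoused, fun k b j hj => ?_⟩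
  refine (countH_of_anchoring A hL hH hmH hmult hscale hhoused hvol k b j hj).trans ?_
  rw [hΛ]
  exact mul_le_mul_of_nonneg_right hN₀ (by positivity)

/-- **END-B-fam's `hcountHq` WITH THE SAME `U`** [bookkeeping]: the weighted anchoring multiplicity alone (`mH ≤ U.N₀`, `U.Λ = L^d`)
gives the cube-side weighted count in the literal shape `DressedRootFam.dressedBudget_of_familyLeaves` asks of ONE cutoff's booking. [folklore] -/
theorem hcountHq_of_anchoring (U : UniformConstants) {d L : ℕ} (A : Anchoring Bk d L) (hL : 0 < L)
    {H : Bk.Birth → ℝ} (hH : ∀ f, 0 ≤ H f) {mH : ℝ}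
    (hmult : ∀ j (x : Fin d → ℕ), ∑ b ∈ Bk.births.filter (fun b => Bk.birthScale b = j ∧ x ∈ A.dom b), H b ≤ mH)
    (hN₀ : mH ≤ U.N₀) (hΛ : U.Λ = (L : ℝ) ^ d) :
    ∀ (q : Bk.Cube) (j : ℕ), j ≤ Bk.cubeScale q → ∑ b ∈ Bk.feltOfScale q j, H b ≤ U.N₀ * U.Λ ^ (Bk.cubeScale q - j) := by
  intro q j _
  refine (weightedCount_of_anchoring A hL hH hmult q j).trans ?_
  rw [hΛ]
  exact mul_le_mul_of_nonneg_right hN₀ (by positivity)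

/-- **ROOT-B FROM THE FAMILY LEAVES OF AN ANCHORED TOWER** [bookkeeping]: END-B-fam `dressedBudget_of_familyLeaves` with its cube-side
binder SUPPLIED by `hcountHq_of_anchoring` at every `(p, K)` — ONE `U`, a family of anchorings `A p K` with a weighted multiplicity `mH ≤ U.N₀`
for the bundles' own weights `(L p K).H`, and weights `0 ≤ w ≤ w̄`.  The remaining binders are the bundles `L p K` themselves. [folklore] -/
theorem dressedBudget_of_familyLeaves_anchored {P : Type*} (U : UniformConstants) (𝒯 : DressedTower P)
    (L : ∀ p K, BookingLeavesFam U (𝒯.B p K) (𝒯.T p K)) {d Lb : ℕ} (A : ∀ p K, Anchoring (𝒯.B p K) d Lb) (hLb : 0 < Lb)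
    (hH : ∀ p K f, 0 ≤ (L p K).H f) {mH : ℝ}
    (hmult : ∀ p K j (x : Fin d → ℕ),
      ∑ b ∈ (𝒯.B p K).births.filter (fun b => (𝒯.B p K).birthScale b = j ∧ x ∈ (A p K).dom b), (L p K).H b ≤ mH)
    (hN₀ : mH ≤ U.N₀) (hΛ : U.Λ = (Lb : ℝ) ^ d) {w : P → ℕ → ℕ → ℝ} {wbar : ℝ} (hwbar : 0 ≤ wbar)
    (hw0 : ∀ p K, ∀ j ≤ K, 0 ≤ w p K j) (hwb : ∀ p K, ∀ j ≤ K, w p K j ≤ wbar) : DressedBudget 𝒯 w :=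
  dressedBudget_of_familyLeaves U 𝒯 L hwbar hw0 hwb fun p K =>
    hcountHq_of_anchoring U (A p K) hLb (hH p K) (hmult p K) hN₀ hΛ

end Summit.QuantumFields.BalabanUV.T4Continuum.NE1p.DressedPositionalCountFam
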